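import Summits.QuantumFields.QCD.Theses.PauliWegnerSea
import Literature.MathematicalPhysics.QuantumFieldTheory.QCDPhaseQuenchedReweighting
import Literature.MathematicalPhysics.QuantumFieldTheory.FermiFlavourPhase

/-!
# `GluonicCompletion` (crux stmt-QuantumFields-9152) — negative-side support: what sign coherence (iv)
# buys for the SIGNED functional, and the modulus-inside form of the flavour-charged decay it needs

Definition-free extract of the standing disprover's `Disproof.lean` (cdisprove g2, §5/§7). Vocabulary: on the
torus of side `S`, `det D = (diracMatrix U m).det` (real, `γ₅`-hermiticity), `μ_W = wilsonMeasure` at coupling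
`β`, `Z₊ = ∫ |det D| dμ_W`, `⟨·⟩₊` the phase-quenched expectation, `W = det/|det|` the sign, and
`⟨X⟩_F(U) = ∫dψ̄dψ X e^{−ψ̄Dψ} / ∫dψ̄dψ e^{−ψ̄Dψ}` the Berezin ratio.

* `qcdTorusExpect_eq_detRatio`: if `det D ≠ 0` a.e., the honest signed functional is
  `⟨X⟩ = ∫ det D · ⟨X⟩_F dμ_W / ∫ det D dμ_W` (orientation sign cancels).
* `integral_norm_det_pos_of_half_le_ratio`, `detRatio_le_two_mul_absMoment`: a sign ratio
  `‖∫ det‖/∫|det| ≥ ½` (clause (iv) of the crux's hypothesis, at that side) makes `Z₊ > 0` and bounds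
  `‖∫ det·Y‖/‖∫ det‖ ≤ 2 ⟨‖Y‖⟩₊` for every observable `Y` — reweighting costs a factor `2` for the ABSOLUTE
  first moment. (That it bounds nothing in terms of `‖⟨Y⟩₊‖` — the form in which `PhaseQuenchedFlavourDecay`
  is filed — is the finite model `reweighting_not_bookkeeping` of the sibling file `Threshold.lean`.)
* `norm_phaseQuenched_le_absMoment`: `‖⟨Y⟩₊‖ ≤ ⟨‖Y‖⟩₊` in the routes' inlined quotient forms (so the
  modulus-inside decay statement implies the filed one).
* `signedCorr_decay_at_own_side`, `chargedConnectedCorr_decay_at_own_side`: sign coherence at the sides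
  `2L_k+1` + modulus-inside phase-quenched decay of `⟨A(0)B(ne₀)⟩_F` + a.e. `det ≠ 0` ⇒ the honest signed
  correlator decays at the same rate with twice the constant, for `n ≤ L_k`; for flavour-charged `A` (tree
  `QCDLatticeObservable.IsFlavourCharged`) this is LITERALLY the `HasLatticeMassGap` inequality at `S = L_k`.
* `chargedLatticeGap_of_allVolume_signCoherence`: the same with sign coherence assumed on ALL tori
  `S ≥ L_k` gives the charged slice of `HasLatticeMassGap` on all tori — isolating what the crux's hypothesis
  does NOT provide; `signRatio_eq_one_of_det_re_nonneg`, `chargedLatticeGap_two_degenerate`: on the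
  non-negative locus (`N_f = 2`, `m_u(k) = m_d(k)`) all-volume sign coherence is free.
* `qcdLatticeConnectedCorr_eq_zero_of_signedZ_eq_zero`: where the signed partition function vanishes the
  honest functional is the junk `x/0 = 0` and `HasLatticeMassGap`'s inequality holds for free.
-/

noncomputable section

namespace Summit.QuantumFields.QCD.Theorems.GluonicCompletion.Negative

open MeasureTheory Filter
open Literature.MathematicalPhysics.QuantumFieldTheory Literature.MathematicalPhysics.QuantumLattice
  Literature.Probability.LatticeModels

variable {Nf : ℕ} {S : ℕ} [NeZero S]

/-- **The honest functional as a `det`-ratio.** If `det D ≠ 0` for `μ_W`-a.e. `U`, then for every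
Grassmann-valued `X`, `qcdTorusExpect β S m X = ∫ det D · ⟨X⟩_F dμ_W / ∫ det D dμ_W` (the orientation
sign `ε` of the Berezin integral cancels; tree `fermiIntegral_fermiBoltzmann`). [folklore] -/
theorem qcdTorusExpect_eq_detRatio (β : ℝ) (mq : Fin Nf → ℝ) (X : GaugeConfig 4 S SU3 → FermiAlg Nf S)
    (h : ∀ᵐ U ∂(wilsonMeasure (d := 4) (L := S) (fundamentalRep (Fin 3)) β), (diracMatrix U mq).det ≠ 0) :
    qcdTorusExpect β S mq X =
      (∫ U, (diracMatrix U mq).det * (fermiIntegral (X U * fermiBoltzmann U mq) / fermiIntegral (fermiBoltzmann U mq))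
          ∂(wilsonMeasure (d := 4) (L := S) (fundamentalRep (Fin 3)) β)) /
        ∫ U, (diracMatrix U mq).det ∂(wilsonMeasure (d := 4) (L := S) (fundamentalRep (Fin 3)) β) := by
  set ε : ℂ := (-1 : ℂ) ^ (Fintype.card (FermiIdx Nf S) * (Fintype.card (FermiIdx Nf S) - 1) / 2 +
    Fintype.card (FermiIdx Nf S)) with hεdef
  have hε : ε ≠ 0 := fermiOrientationSign_ne_zero _
  have hnum : (fun U => fermiIntegral (X U * fermiBoltzmann U mq))
      =ᵐ[wilsonMeasure (d := 4) (L := S) (fundamentalRep (Fin 3)) β]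
      fun U => ε * ((diracMatrix U mq).det *
        (fermiIntegral (X U * fermiBoltzmann U mq) / fermiIntegral (fermiBoltzmann U mq))) := by
    filter_upwards [h] with U hU
    rw [fermiIntegral_fermiBoltzmann, ← hεdef]
    field_simp
  have hden : (fun U : GaugeConfig 4 S SU3 => fermiIntegral (fermiBoltzmann U mq)) =
      fun U => ε * (diracMatrix U mq).det :=
    funext fun U => by rw [fermiIntegral_fermiBoltzmann, ← hεdef]
  unfold qcdTorusExpect
  rw [integral_congr_ae hnum, hden, integral_const_mul, integral_const_mul, mul_div_mul_left _ _ hε]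

/-- A sign ratio `≥ ½` forces a positive phase-quenched partition function `Z₊ = ∫ |det D| dμ_W > 0`
(else the ratio is the junk `x/0 = 0`). [folklore] -/
theorem integral_norm_det_pos_of_half_le_ratio (β : ℝ) (mq : Fin Nf → ℝ)
    (h : (1 / 2 : ℝ) ≤ ‖∫ U, (diracMatrix U mq).det ∂(wilsonMeasure (d := 4) (L := S) (fundamentalRep (Fin 3)) β)‖ /
      ∫ U, ‖(diracMatrix U mq).det‖ ∂(wilsonMeasure (d := 4) (L := S) (fundamentalRep (Fin 3)) β)) :
    0 < ∫ U, ‖(diracMatrix U mq).det‖ ∂(wilsonMeasure (d := 4) (L := S) (fundamentalRep (Fin 3)) β) := by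
  rcases (integral_nonneg fun U => norm_nonneg ((diracMatrix U mq).det) :
      (0 : ℝ) ≤ ∫ U, ‖(diracMatrix U mq).det‖
        ∂(wilsonMeasure (d := 4) (L := S) (fundamentalRep (Fin 3)) β)).lt_or_eq with hpos | h0
  · exact hpos
  · rw [← h0, div_zero] at h
    norm_num at h

/-- **Sign reweighting costs a factor `2` — for the ABSOLUTE first moment.** Under a sign ratio `≥ ½`, for
every complex observable `Y` of the gauge field:
`‖∫ det D · Y dμ_W‖ / ‖∫ det D dμ_W‖ ≤ 2 · (∫ |det D| ‖Y‖ dμ_W / ∫ |det D| dμ_W) = 2 ⟨‖Y‖⟩₊`. [folklore] -/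
theorem detRatio_le_two_mul_absMoment (β : ℝ) (mq : Fin Nf → ℝ) (Y : GaugeConfig 4 S SU3 → ℂ)
    (hIV : (1 / 2 : ℝ) ≤ ‖∫ U, (diracMatrix U mq).det ∂(wilsonMeasure (d := 4) (L := S) (fundamentalRep (Fin 3)) β)‖ /
      ∫ U, ‖(diracMatrix U mq).det‖ ∂(wilsonMeasure (d := 4) (L := S) (fundamentalRep (Fin 3)) β)) :
    ‖∫ U, (diracMatrix U mq).det * Y U ∂(wilsonMeasure (d := 4) (L := S) (fundamentalRep (Fin 3)) β)‖ /
        ‖∫ U, (diracMatrix U mq).det ∂(wilsonMeasure (d := 4) (L := S) (fundamentalRep (Fin 3)) β)‖ ≤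
      2 * ((∫ U, ‖(diracMatrix U mq).det‖ * ‖Y U‖ ∂(wilsonMeasure (d := 4) (L := S) (fundamentalRep (Fin 3)) β)) /
        ∫ U, ‖(diracMatrix U mq).det‖ ∂(wilsonMeasure (d := 4) (L := S) (fundamentalRep (Fin 3)) β)) := by
  set μ := wilsonMeasure (d := 4) (L := S) (fundamentalRep (Fin 3)) β with hμ
  have hZ : 0 < ∫ U, ‖(diracMatrix U mq).det‖ ∂μ := integral_norm_det_pos_of_half_le_ratio β mq hIV
  set Zs : ℝ := ‖∫ U, (diracMatrix U mq).det ∂μ‖ with hZs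
  have hZs : (∫ U, ‖(diracMatrix U mq).det‖ ∂μ) / 2 ≤ Zs := by
    have := (le_div_iff₀ hZ).1 hIV
    linarith
  have hZs_pos : 0 < Zs := lt_of_lt_of_le (by linarith) hZs
  set M : ℝ := ∫ U, ‖(diracMatrix U mq).det‖ * ‖Y U‖ ∂μ with hM
  have hM0 : 0 ≤ M := integral_nonneg fun U => mul_nonneg (norm_nonneg _) (norm_nonneg _)
  have hnum : ‖∫ U, (diracMatrix U mq).det * Y U ∂μ‖ ≤ M := by
    refine (norm_integral_le_integral_norm _).trans (le_of_eq ?_)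
    congr 1
    funext U
    rw [norm_mul]
  calc ‖∫ U, (diracMatrix U mq).det * Y U ∂μ‖ / Zs ≤ M / Zs := div_le_div_of_nonneg_right hnum hZs_pos.le
    _ ≤ M / ((∫ U, ‖(diracMatrix U mq).det‖ ∂μ) / 2) := div_le_div_of_nonneg_left hM0 (by linarith) hZs
    _ = 2 * (M / ∫ U, ‖(diracMatrix U mq).det‖ ∂μ) := by
      field_simp

/-- `‖⟨Y⟩₊‖ ≤ ⟨‖Y‖⟩₊` in the routes' inlined quotient forms (both sides are the junk `0` when the
denominator vanishes): the modulus-inside decay statement implies the filed (modulus-outside) one. [folklore] -/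
theorem norm_phaseQuenched_le_absMoment (β : ℝ) (mq : Fin Nf → ℝ) (Y : GaugeConfig 4 S SU3 → ℂ) :
    ‖(∫ U, (‖(diracMatrix U mq).det‖ : ℂ) * Y U ∂(wilsonMeasure (d := 4) (L := S) (fundamentalRep (Fin 3)) β)) /
        ∫ U, (‖(diracMatrix U mq).det‖ : ℂ) ∂(wilsonMeasure (d := 4) (L := S) (fundamentalRep (Fin 3)) β)‖ ≤
      (∫ U, ‖(diracMatrix U mq).det‖ * ‖Y U‖ ∂(wilsonMeasure (d := 4) (L := S) (fundamentalRep (Fin 3)) β)) /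
        ∫ U, ‖(diracMatrix U mq).det‖ ∂(wilsonMeasure (d := 4) (L := S) (fundamentalRep (Fin 3)) β) := by
  set μ := wilsonMeasure (d := 4) (L := S) (fundamentalRep (Fin 3)) β with hμ
  have h0 : (0 : ℝ) ≤ ∫ U, ‖(diracMatrix U mq).det‖ ∂μ := integral_nonneg fun U => norm_nonneg _
  rw [norm_div, integral_complex_ofReal, Complex.norm_real, Real.norm_eq_abs, abs_of_nonneg h0]
  rcases h0.lt_or_eq with hpos | h00
  · refine div_le_div_of_nonneg_right ((norm_integral_le_integral_norm _).trans (le_of_eq ?_)) hpos.le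
    congr 1
    funext U
    rw [norm_mul, Complex.norm_real, Real.norm_eq_abs, abs_of_nonneg (norm_nonneg _)]
  · rw [← h00, div_zero, div_zero]

/-- **Signed decay at the scheme's own side.** Along a sequence of torus half-sides `L_k`, couplings `β_k`,
spacings `a_k` and bare-mass families `m(k)`: sign coherence `≥ ½` at side `2L_k+1` (clause (iv)), the
modulus-INSIDE phase-quenched decay of the Berezin ratio of `X(0)·X'(ne₀)` at rate `δ'` with constant `C'`,
and `det ≠ 0` a.e. there, give `‖⟨X(0) X'(ne₀)⟩_k‖ ≤ 2C' e^{−δ' a_k n}` for the honest SIGNED functional,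
`n ≤ L_k`, all large `k`. [folklore] -/
theorem signedCorr_decay_at_own_side (L : ℕ → ℕ) (a β : ℕ → ℝ) (mb : ℕ → Fin Nf → ℝ)
    (X X' : (T : ℕ) → [NeZero T] → GaugeConfig 4 T SU3 → FermiAlg Nf T) (δ' C' : ℝ)
    (hIV : ∀ᶠ k in atTop, (1 / 2 : ℝ) ≤
      ‖∫ U, (diracMatrix U (mb k)).det ∂(wilsonMeasure (d := 4) (L := 2 * L k + 1) (fundamentalRep (Fin 3)) (β k))‖ /
        ∫ U, ‖(diracMatrix U (mb k)).det‖ ∂(wilsonMeasure (d := 4) (L := 2 * L k + 1) (fundamentalRep (Fin 3)) (β k)))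
    (hP : ∀ᶠ k in atTop, ∀ n : ℕ, n ≤ L k →
      (∫ U, ‖(diracMatrix U (mb k)).det‖ *
          ‖fermiIntegral (X (2 * L k + 1) U * X' (2 * L k + 1) U * fermiBoltzmann U (mb k)) /
            fermiIntegral (fermiBoltzmann U (mb k))‖
          ∂(wilsonMeasure (d := 4) (L := 2 * L k + 1) (fundamentalRep (Fin 3)) (β k))) /
        (∫ U, ‖(diracMatrix U (mb k)).det‖ ∂(wilsonMeasure (d := 4) (L := 2 * L k + 1) (fundamentalRep (Fin 3)) (β k))) ≤
        C' * Real.exp (-(δ' * (a k * n))))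
    (hae : ∀ᶠ k in atTop, ∀ᵐ U ∂(wilsonMeasure (d := 4) (L := 2 * L k + 1) (fundamentalRep (Fin 3)) (β k)),
      (diracMatrix U (mb k)).det ≠ 0) :
    ∀ᶠ k in atTop, ∀ n : ℕ, n ≤ L k →
      ‖qcdTorusExpect (β k) (2 * L k + 1) (mb k) (fun U => X (2 * L k + 1) U * X' (2 * L k + 1) U)‖ ≤
        2 * C' * Real.exp (-(δ' * (a k * n))) := by
  filter_upwards [hIV, hP, hae] with k hk hk' hk'' n hn
  rw [qcdTorusExpect_eq_detRatio _ _ _ hk'', norm_div, mul_assoc]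
  exact (detRatio_le_two_mul_absMoment _ _ _ hk).trans (mul_le_mul_of_nonneg_left (hk' n hn) (by norm_num))

/-- **The flavour-charged slice of `HasLatticeMassGap` at `S = L_k`.** For a flavour-charged `A` (tree
`QCDLatticeObservable.IsFlavourCharged`, charge `q ≠ 0`) the connected and full correlators coincide, so
sign coherence at side `2L_k+1` + modulus-inside phase-quenched decay of `⟨A(0)B(ne₀)⟩_F` + a.e. `det ≠ 0`
give LITERALLY the `HasLatticeMassGap δ'` inequality for `(A, B)` — at the single side `S = L_k`. [folklore] -/
theorem chargedConnectedCorr_decay_at_own_side (L : ℕ → ℕ) (a β : ℕ → ℝ) (mb : ℕ → Fin Nf → ℝ)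
    {R R' : ℕ} (A : QCDLatticeObservable Nf R) (B : QCDLatticeObservable Nf R') {f₀ : Fin Nf} {q : ℤ}
    (hA : A.IsFlavourCharged f₀ q) (hq : q ≠ 0) (δ' C' : ℝ)
    (hIV : ∀ᶠ k in atTop, (1 / 2 : ℝ) ≤
      ‖∫ U, (diracMatrix U (mb k)).det ∂(wilsonMeasure (d := 4) (L := 2 * L k + 1) (fundamentalRep (Fin 3)) (β k))‖ /
        ∫ U, ‖(diracMatrix U (mb k)).det‖ ∂(wilsonMeasure (d := 4) (L := 2 * L k + 1) (fundamentalRep (Fin 3)) (β k)))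
    (hP : ∀ᶠ k in atTop, ∀ n : ℕ, n ≤ L k →
      (∫ U, ‖(diracMatrix U (mb k)).det‖ *
          ‖fermiIntegral (A.onTorus (2 * L k + 1) 0 U * B.onTorus (2 * L k + 1) (Pi.single 0 (n : ℤ)) U *
              fermiBoltzmann U (mb k)) / fermiIntegral (fermiBoltzmann U (mb k))‖
          ∂(wilsonMeasure (d := 4) (L := 2 * L k + 1) (fundamentalRep (Fin 3)) (β k))) /
        (∫ U, ‖(diracMatrix U (mb k)).det‖ ∂(wilsonMeasure (d := 4) (L := 2 * L k + 1) (fundamentalRep (Fin 3)) (β k))) ≤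
        C' * Real.exp (-(δ' * (a k * n))))
    (hae : ∀ᶠ k in atTop, ∀ᵐ U ∂(wilsonMeasure (d := 4) (L := 2 * L k + 1) (fundamentalRep (Fin 3)) (β k)),
      (diracMatrix U (mb k)).det ≠ 0) :
    ∀ᶠ k in atTop, ∀ n : ℕ, n ≤ L k →
      ‖qcdLatticeConnectedCorr (β k) (2 * L k + 1) (mb k) A B n‖ ≤ 2 * C' * Real.exp (-(δ' * (a k * n))) := by
  filter_upwards [hIV, hP, hae] with k hk hk' hk'' n hn
  rw [hA.qcdLatticeConnectedCorr_eq hq, qcdTorusExpect_eq_detRatio _ _ _ hk'', norm_div, mul_assoc]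
  exact (detRatio_le_two_mul_absMoment _ _ _ hk).trans (mul_le_mul_of_nonneg_left (hk' n hn) (by norm_num))

/-- **What ALL-volume sign coherence would buy: the charged slice of `HasLatticeMassGap` on all tori.**
The same, with sign coherence `≥ ½` assumed on EVERY torus of side `2S+1 ≥ 2L_k+1` — precisely the input
the crux's hypothesis does NOT contain (it pins the sign at `S = L_k` only). [folklore] -/
theorem chargedLatticeGap_of_allVolume_signCoherence (L : ℕ → ℕ) (a β : ℕ → ℝ) (mb : ℕ → Fin Nf → ℝ)
    {R R' : ℕ} (A : QCDLatticeObservable Nf R) (B : QCDLatticeObservable Nf R') {f₀ : Fin Nf} {q : ℤ}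
    (hA : A.IsFlavourCharged f₀ q) (hq : q ≠ 0) (δ' C' : ℝ)
    (hIV : ∀ᶠ k in atTop, ∀ S : ℕ, L k ≤ S → (1 / 2 : ℝ) ≤
      ‖∫ U, (diracMatrix U (mb k)).det ∂(wilsonMeasure (d := 4) (L := 2 * S + 1) (fundamentalRep (Fin 3)) (β k))‖ /
        ∫ U, ‖(diracMatrix U (mb k)).det‖ ∂(wilsonMeasure (d := 4) (L := 2 * S + 1) (fundamentalRep (Fin 3)) (β k)))
    (hP : ∀ᶠ k in atTop, ∀ S : ℕ, L k ≤ S → ∀ n : ℕ, n ≤ S →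
      (∫ U, ‖(diracMatrix U (mb k)).det‖ *
          ‖fermiIntegral (A.onTorus (2 * S + 1) 0 U * B.onTorus (2 * S + 1) (Pi.single 0 (n : ℤ)) U *
              fermiBoltzmann U (mb k)) / fermiIntegral (fermiBoltzmann U (mb k))‖
          ∂(wilsonMeasure (d := 4) (L := 2 * S + 1) (fundamentalRep (Fin 3)) (β k))) /
        (∫ U, ‖(diracMatrix U (mb k)).det‖ ∂(wilsonMeasure (d := 4) (L := 2 * S + 1) (fundamentalRep (Fin 3)) (β k))) ≤
        C' * Real.exp (-(δ' * (a k * n))))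
    (hae : ∀ᶠ k in atTop, ∀ S : ℕ, L k ≤ S →
      ∀ᵐ U ∂(wilsonMeasure (d := 4) (L := 2 * S + 1) (fundamentalRep (Fin 3)) (β k)), (diracMatrix U (mb k)).det ≠ 0) :
    ∀ᶠ k in atTop, ∀ S : ℕ, L k ≤ S → ∀ n : ℕ, n ≤ S →
      ‖qcdLatticeConnectedCorr (β k) (2 * S + 1) (mb k) A B n‖ ≤ 2 * C' * Real.exp (-(δ' * (a k * n))) := by
  filter_upwards [hIV, hP, hae] with k hk hk' hk'' S hS n hn
  rw [hA.qcdLatticeConnectedCorr_eq hq, qcdTorusExpect_eq_detRatio _ _ _ (hk'' S hS), norm_div, mul_assoc]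
  exact (detRatio_le_two_mul_absMoment _ _ _ (hk S hS)).trans
    (mul_le_mul_of_nonneg_left (hk' S hS n hn) (by norm_num))

/-- **On the non-negative locus the sign ratio is `1`**: if `Re det D ≥ 0` for every gauge field and `det ≠ 0`
a.e., then `‖∫ det D dμ_W‖ / ∫ |det D| dμ_W = 1`. [folklore] -/
theorem signRatio_eq_one_of_det_re_nonneg (β : ℝ) (mq : Fin Nf → ℝ)
    (hnn : ∀ U : GaugeConfig 4 S SU3, 0 ≤ ((diracMatrix U mq).det).re)
    (hae : ∀ᵐ U ∂(wilsonMeasure (d := 4) (L := S) (fundamentalRep (Fin 3)) β), (diracMatrix U mq).det ≠ 0) :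
    ‖∫ U, (diracMatrix U mq).det ∂(wilsonMeasure (d := 4) (L := S) (fundamentalRep (Fin 3)) β)‖ /
        ∫ U, ‖(diracMatrix U mq).det‖ ∂(wilsonMeasure (d := 4) (L := S) (fundamentalRep (Fin 3)) β) = 1 := by
  have hZ := integral_norm_det_diracMatrix_pos β mq hae
  have hre : ∀ U : GaugeConfig 4 S SU3, (diracMatrix U mq).det = ((‖(diracMatrix U mq).det‖ : ℝ) : ℂ) :=
    fun U => by
      rw [norm_det_diracMatrix_eq_abs_re, abs_of_nonneg (hnn U)]
      exact det_diracMatrix_eq_ofReal_re U mq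
  rw [show (fun U : GaugeConfig 4 S SU3 => (diracMatrix U mq).det) =
      fun U => ((‖(diracMatrix U mq).det‖ : ℝ) : ℂ) from funext hre]
  rw [integral_complex_ofReal, Complex.norm_real, Real.norm_eq_abs, abs_of_pos hZ, div_self hZ.ne']

/-- Two mass-DEGENERATE Wilson flavours: `det D = (det D_W)² ≥ 0` configuration-wise. [folklore] -/
theorem det_re_nonneg_two_degenerate (U : GaugeConfig 4 S SU3) (mq : Fin 2 → ℝ) (h : mq 0 = mq 1) :
    0 ≤ ((diracMatrix U mq).det).re := by
  rw [det_diracMatrix, Fin.prod_univ_two, ← h]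
  have him : (fermionDet (wilsonDirac (fundamentalRep (Fin 3)) U (mq 0) 1)).im = 0 :=
    fermionDet_wilsonDirac_im_holds (L := S) (fundamentalRep (Fin 3))
      (fun g => fundamentalRep_mem_unitaryGroup g) U (mq 0) 1
  rw [Complex.mul_re, him, mul_zero, sub_zero]
  exact mul_self_nonneg _

/-- **The isospin-symmetric two-flavour slice.** For `N_f = 2` with degenerate bare masses
`m_u(k) = m_d(k)` (no sign problem on any torus) the modulus-inside phase-quenched decay of a charged
correlator (with a.e. `det ≠ 0`) yields the `HasLatticeMassGap` inequality for that pair on ALL tori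
`S ≥ L_k`. [folklore] -/
theorem chargedLatticeGap_two_degenerate (L : ℕ → ℕ) (a β : ℕ → ℝ) (mb : ℕ → Fin 2 → ℝ)
    (hmb : ∀ k, mb k 0 = mb k 1)
    {R R' : ℕ} (A : QCDLatticeObservable 2 R) (B : QCDLatticeObservable 2 R') {f₀ : Fin 2} {q : ℤ}
    (hA : A.IsFlavourCharged f₀ q) (hq : q ≠ 0) (δ' C' : ℝ)
    (hP : ∀ᶠ k in atTop, ∀ S : ℕ, L k ≤ S → ∀ n : ℕ, n ≤ S →
      (∫ U, ‖(diracMatrix U (mb k)).det‖ *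
          ‖fermiIntegral (A.onTorus (2 * S + 1) 0 U * B.onTorus (2 * S + 1) (Pi.single 0 (n : ℤ)) U *
              fermiBoltzmann U (mb k)) / fermiIntegral (fermiBoltzmann U (mb k))‖
          ∂(wilsonMeasure (d := 4) (L := 2 * S + 1) (fundamentalRep (Fin 3)) (β k))) /
        (∫ U, ‖(diracMatrix U (mb k)).det‖ ∂(wilsonMeasure (d := 4) (L := 2 * S + 1) (fundamentalRep (Fin 3)) (β k))) ≤
        C' * Real.exp (-(δ' * (a k * n))))
    (hae : ∀ᶠ k in atTop, ∀ S : ℕ, L k ≤ S →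
      ∀ᵐ U ∂(wilsonMeasure (d := 4) (L := 2 * S + 1) (fundamentalRep (Fin 3)) (β k)), (diracMatrix U (mb k)).det ≠ 0) :
    ∀ᶠ k in atTop, ∀ S : ℕ, L k ≤ S → ∀ n : ℕ, n ≤ S →
      ‖qcdLatticeConnectedCorr (β k) (2 * S + 1) (mb k) A B n‖ ≤ 2 * C' * Real.exp (-(δ' * (a k * n))) := by
  refine chargedLatticeGap_of_allVolume_signCoherence L a β mb A B hA hq δ' C' ?_ hP hae
  filter_upwards [hae] with k hk S hS
  rw [signRatio_eq_one_of_det_re_nonneg (S := 2 * S + 1) (β k) (mb k)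
    (fun U => det_re_nonneg_two_degenerate U _ (hmb k)) (hk S hS)]
  norm_num

/-- **Junk alert.** Where the SIGNED partition function `∫ det D dμ_W` vanishes, the honest functional
`qcdTorusExpect` is the junk `x/0 = 0` for every insertion, so every connected correlator is `0` and the
`HasLatticeMassGap` inequality holds there for free; sign coherence (iv) excludes this at the scheme's own
side only. [folklore] -/
theorem qcdLatticeConnectedCorr_eq_zero_of_signedZ_eq_zero (β : ℝ) (mq : Fin Nf → ℝ)
    (h : (∫ U, (diracMatrix U mq).det ∂(wilsonMeasure (d := 4) (L := S) (fundamentalRep (Fin 3)) β)) = 0)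
    {R R' : ℕ} (A : QCDLatticeObservable Nf R) (B : QCDLatticeObservable Nf R') (n : ℕ) :
    qcdLatticeConnectedCorr β S mq A B n = 0 := by
  have hZ : (∫ U, fermiIntegral (fermiBoltzmann U mq)
      ∂(wilsonMeasure (d := 4) (L := S) (fundamentalRep (Fin 3)) β)) = 0 := by
    simp_rw [fermiIntegral_fermiBoltzmann]
    rw [integral_const_mul, h, mul_zero]
  simp [qcdLatticeConnectedCorr, qcdTorusExpect, hZ]

end Summit.QuantumFields.QCD.Theorems.GluonicCompletion.Negative

end
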